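import Summits.Ventures.HSemireg.WedgeHankelClassSpaceAlgebra
import Summits.Ventures.HSemireg.WedgeHankelSiegelClassesStable
import Mathlib.LinearAlgebra.Eigenspace.Minpoly

/-!
# Venture HSemireg — THE QUARTER TURN `SbC(0 −1 1 0)` ON TH-7's CLASSES: `Q² = (−1)^n`, `Q E_n = E_0`, `Q` is never a scalar (`n ≥ 1`), and its MINIMAL POLYNOMIAL IS
# `X² − (−1)^n` over EVERY field — for `n` odd over a field without `√−1` the quarter turn has NO eigen-class at all (an elliptic substitution: semisimple, not split),
# for `n` even its eigenvalues are exactly `±1`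

HONEST FRAMING. Part of the Lean index of the computation cell `pub-hsemireg` (seat p10 gen 21, Sunday typer «UNIFORM-IN-n»).
Finite-dimensional EXTERIOR ALGEBRA + linear algebra ONLY: no variety, no cohomology theory, no sheaf, no Ext group, no semiregularity map;
nothing here says that HC / HC_CM / HC_AV holds; no Literature fact is declared or used.  Custodian versions as in `WedgeHankelSiegelIdeal` (1/3) and `WedgeHankelFrameChange`;
the dictionary (the quarter turn `x ↦ y, y ↦ −x` of the letters' plane acting on `Sym^n`; its fixed nodes `±√−1`) is QUOTED, never asserted.

WHAT IS IN THE TREE.  J5 (`WedgeHankelClassSpaceAlgebra`): `SbC_mul` (`SbC(g′)·SbC(g) = SbC(g·g′)`), `SbC_scalar` (`SbC(t 0 0 t) = t^n • 1`); J8 `Sb_w_spike_top` (`Sb g E_n =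
w_n(γ^{n−j}δ^j)`); H1b `w_eq_w_iff`; J17/J19/K2 treat substitutions WITH `K`-rational fixed nodes (semisimple split), J1/J10 singular ones, J3/J4/J11/K1 parabolic ones.  The
ELLIPTIC case (no fixed node in `K`) was untyped.  THIS FILE (namespace `Summit.Ventures.HSemireg.Wedge.HankelFrameChange` continued; imports J5, J8,
`Mathlib.LinearAlgebra.Eigenspace.Minpoly`) types its simplest instance:
* §288 **`SbC_quarter_mul_self`** (`SbC(0 −1 1 0)² = (−1)^n • 1`), `SbC_quarter_pow_four` (`Q⁴ = 1`), **`SbC_quarter_spike_top`** (`Q E_n = E_0`), **`SbC_quarter_ne_smul_one`**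
  (`n ≥ 1`: `Q` is not a scalar), `aeval_SbC_quarter`.
* §289 **`minpoly_SbC_quarter`: `minpoly (SbC(0 −1 1 0)) = X² − C((−1)^n)` for every `n ≥ 1` over EVERY field** (`minpoly.unique`: no monic polynomial of degree `≤ 1` kills a
  non-scalar), `minpoly_SbC_quarter_even` (`X² − 1`), `minpoly_SbC_quarter_odd` (`X² + 1`); **`hasEigenvalue_SbC_quarter_iff`** (`μ` is an eigenvalue iff `μ² = (−1)^n`),
  **`not_hasEigenvalue_SbC_quarter_of_odd`** (`n` odd, `−1` not a square in `K` ⇒ NO eigenvalue: no eigen-class over `ℚ`, `ℝ`, `𝔽_p` with `p ≡ 3 (4)`),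
  `hasEigenvalue_SbC_quarter_iff_of_even` (`n` even: eigenvalues exactly `±1`), `SbC_quarter_apply_ne_smul_of_odd`.
NOT typed here: the eigenspace dimensions of the quarter turn for `n` even (`⌊n/2⌋ + 1` and `⌈n/2⌉`... not typed); general elliptic `g` (minimal polynomial = the Frobenius-twist-free
analogue `X² − tr(g^{(n)})X + …` only for `n = 1`); anything Ext-side.  New names only.
-/

open Module

namespace Summit.Ventures.HSemireg.Wedge.HankelFrameChange

open Summit.Ventures.HSemireg.Wedge Summit.Ventures.HSemireg.Wedge.Kunneth Summit.Ventures.HSemireg.Wedge.Hankel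
  Summit.Ventures.HSemireg.Wedge.BasisFree Summit.Ventures.HSemireg.Wedge.HankelSiegel Summit.Ventures.HSemireg.Wedge.HankelSiegelIdeal
  Summit.Ventures.HSemireg.Wedge.KunnethKernel Summit.Ventures.HSemireg.Wedge.HankelRankOne Summit.Ventures.HSemireg.Wedge.KernelDuality

variable (K : Type*) [Field K] {n : ℕ}

/-! ## §288. The quarter turn: square, fourth power, the point class goes to the pure class, never a scalar -/

/-- **`SbC(0 −1 1 0)·SbC(0 −1 1 0) = (−1)^n • 1`** on th-7's classes (`(0 −1; 1 0)² = −1` and `SbC(−1 0 0 −1) = (−1)^n • 1`). -/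
theorem SbC_quarter_mul_self : SbC K 0 (-1) 1 0 (n := n) * SbC K 0 (-1) 1 0 = (-1 : K) ^ n • (1 : spikeSpan K n →ₗ[K] spikeSpan K n) := by
  rw [SbC_mul, ← SbC_scalar]
  congr 1 <;> ring

/-- `SbC(0 −1 1 0)^2 = (−1)^n • 1`. -/
theorem SbC_quarter_sq : SbC K 0 (-1) 1 0 (n := n) ^ 2 = (-1 : K) ^ n • (1 : spikeSpan K n →ₗ[K] spikeSpan K n) := by
  rw [pow_two, SbC_quarter_mul_self]

/-- `SbC(0 −1 1 0)^4 = 1`: the quarter turn has order dividing `4` on the classes. -/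
theorem SbC_quarter_pow_four : SbC K 0 (-1) 1 0 (n := n) ^ 4 = 1 := by
  rw [show 4 = 2 * 2 by rfl, pow_mul, SbC_quarter_sq, _root_.smul_pow, one_pow, ← pow_mul, mul_comm, pow_mul, neg_one_sq, one_pow, one_smul]

/-- **the quarter turn sends the point class to the pure class: `SbC(0 −1 1 0) E_n = E_0`** (J8 `Sb_w_spike_top`: `w_n(1^{n−j}·0^j) = E_0`). -/
theorem SbC_quarter_spike_top :
    SbC K 0 (-1) 1 0 (⟨w K n n (fun j => if j = n then (1 : K) else 0), w_mem_spikeSpan K _⟩ : spikeSpan K n) =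
      ⟨w K n n (fun j => if j = 0 then (1 : K) else 0), w_mem_spikeSpan K _⟩ := by
  apply Subtype.ext
  rw [SbC_apply_coe, Sb_w_spike_top]
  refine w_eq_of_agree K n fun j _ => ?_
  by_cases hj : j = 0
  · rw [hj, if_pos rfl, pow_zero, one_pow, one_mul]
  · rw [if_neg hj, zero_pow hj, mul_zero]

/-- **`n ≥ 1`: the quarter turn is NOT a scalar on th-7's classes** (it moves `E_n` to `E_0`). -/
theorem SbC_quarter_ne_smul_one (hn : 1 ≤ n) (c : K) : SbC K 0 (-1) 1 0 (n := n) ≠ c • (1 : spikeSpan K n →ₗ[K] spikeSpan K n) := by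
  intro h
  have e := congrArg (fun φ : spikeSpan K n →ₗ[K] spikeSpan K n => (φ ⟨w K n n (fun j => if j = n then (1 : K) else 0), w_mem_spikeSpan K _⟩ : HT K (In n))) h
  simp only [SbC_quarter_spike_top, LinearMap.smul_apply, Module.End.one_apply, Submodule.coe_smul] at e
  rw [← w_smul] at e
  have h0 := (w_eq_w_iff K _ _).1 e 0 (Nat.zero_le n)
  rw [if_pos rfl, if_neg (by omega), mul_zero] at h0
  exact one_ne_zero h0

/-- `X² − C((−1)^n)` kills the quarter turn. -/
theorem aeval_SbC_quarter : Polynomial.aeval (SbC K 0 (-1) 1 0 (n := n)) (Polynomial.X ^ 2 - Polynomial.C ((-1 : K) ^ n)) = 0 := by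
  rw [map_sub, map_pow, Polynomial.aeval_X, Polynomial.aeval_C, SbC_quarter_sq, Algebra.algebraMap_eq_smul_one, sub_self]

/-! ## §289. The minimal polynomial `X² − (−1)^n` and the eigenvalues -/

/-- a non-scalar endomorphism is killed by no monic polynomial of degree `< 2`. -/
theorem two_le_natDegree_of_aeval_eq_zero_of_ne_smul_one {V : Type*} [AddCommGroup V] [Module K V] [Nontrivial V] {T : V →ₗ[K] V} (hT : ∀ c : K, T ≠ c • 1) {q : Polynomial K}
    (hq : q.Monic) (hTq : Polynomial.aeval T q = 0) : 2 ≤ q.natDegree := by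
  by_contra hlt
  rw [not_le] at hlt
  rcases Nat.lt_or_ge q.natDegree 1 with h0 | h1
  · -- degree 0: `q = 1`
    have e : q = 1 := Polynomial.eq_one_of_monic_natDegree_zero hq (by omega)
    rw [e, map_one] at hTq
    exact one_ne_zero hTq
  · -- degree 1: `q = Polynomial.X + Polynomial.C (q.coeff 0)`, so `T = −q.coeff 0 • 1`
    have e : q = Polynomial.X + Polynomial.C (q.coeff 0) := hq.eq_X_add_C (by omega)
    rw [e, map_add, Polynomial.aeval_X, Polynomial.aeval_C, Algebra.algebraMap_eq_smul_one, add_eq_zero_iff_eq_neg, ← neg_smul] at hTq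
    exact hT _ hTq

/-- **THE MINIMAL POLYNOMIAL OF THE QUARTER TURN ON TH-7's CLASSES IS `X² − (−1)^n`, for every `n ≥ 1` over EVERY field** (it kills `Q`, and no monic polynomial of smaller degree
kills the non-scalar `Q`; in characteristic `2` this reads `(X − 1)²`: the quarter turn is then unipotent, not semisimple). -/
theorem minpoly_SbC_quarter (hn : 1 ≤ n) : minpoly K (SbC K 0 (-1) 1 0 (n := n)) = Polynomial.X ^ 2 - Polynomial.C ((-1 : K) ^ n) := by
  haveI : Nontrivial (spikeSpan K n) := nontrivial_of_ne (spikeBasis K n 0) 0 ((spikeBasis K n).ne_zero 0)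
  have hmonic : (Polynomial.X ^ 2 - Polynomial.C ((-1 : K) ^ n)).Monic := Polynomial.monic_X_pow_sub_C _ two_ne_zero
  symm
  refine minpoly.unique K _ hmonic (aeval_SbC_quarter K) fun q hq hq0 => ?_
  rw [Polynomial.degree_eq_natDegree hmonic.ne_zero, Polynomial.degree_eq_natDegree hq.ne_zero, Polynomial.natDegree_X_pow_sub_C, Nat.cast_le]
  exact two_le_natDegree_of_aeval_eq_zero_of_ne_smul_one K (SbC_quarter_ne_smul_one K hn) hq hq0

/-- `n` even (`n ≥ 1`): `minpoly (SbC(0 −1 1 0)) = X² − 1`. -/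
theorem minpoly_SbC_quarter_even (hn : 1 ≤ n) (he : Even n) : minpoly K (SbC K 0 (-1) 1 0 (n := n)) = Polynomial.X ^ 2 - 1 := by
  rw [minpoly_SbC_quarter K hn, he.neg_one_pow, Polynomial.C_1]

/-- `n` odd: `minpoly (SbC(0 −1 1 0)) = X² + 1`. -/
theorem minpoly_SbC_quarter_odd (ho : Odd n) : minpoly K (SbC K 0 (-1) 1 0 (n := n)) = Polynomial.X ^ 2 + 1 := by
  rw [minpoly_SbC_quarter K ho.pos, ho.neg_one_pow, Polynomial.C_neg, Polynomial.C_1, sub_neg_eq_add]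

/-- **the eigenvalues of the quarter turn are exactly the square roots of `(−1)^n` in `K`** (`n ≥ 1`; roots of the minimal polynomial). -/
theorem hasEigenvalue_SbC_quarter_iff (hn : 1 ≤ n) (μ : K) : Module.End.HasEigenvalue (SbC K 0 (-1) 1 0 (n := n)) μ ↔ μ ^ 2 = (-1 : K) ^ n := by
  rw [Module.End.hasEigenvalue_iff_isRoot, minpoly_SbC_quarter K hn, Polynomial.IsRoot.def, Polynomial.eval_sub, Polynomial.eval_pow, Polynomial.eval_X, Polynomial.eval_C, sub_eq_zero]

/-- **`n` ODD OVER A FIELD WITHOUT `√−1`: THE QUARTER TURN HAS NO EIGENVALUE — no eigen-class at all on th-7's classes** (`ℚ`, `ℝ`, `𝔽_p` with `p ≡ 3 mod 4`): an elliptic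
substitution, semisimple but not split. -/
theorem not_hasEigenvalue_SbC_quarter_of_odd (ho : Odd n) (hK : ∀ x : K, x ^ 2 ≠ -1) (μ : K) : ¬ Module.End.HasEigenvalue (SbC K 0 (-1) 1 0 (n := n)) μ := by
  rw [hasEigenvalue_SbC_quarter_iff K ho.pos, ho.neg_one_pow]
  exact hK μ

/-- `n` even (`n ≥ 1`): the eigenvalues of the quarter turn are exactly `1` and `−1`. -/
theorem hasEigenvalue_SbC_quarter_iff_of_even (hn : 1 ≤ n) (he : Even n) (μ : K) :
    Module.End.HasEigenvalue (SbC K 0 (-1) 1 0 (n := n)) μ ↔ μ = 1 ∨ μ = -1 := by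
  rw [hasEigenvalue_SbC_quarter_iff K hn, he.neg_one_pow, ← sub_eq_zero, show μ ^ 2 - 1 = (μ - 1) * (μ + 1) by ring, mul_eq_zero, sub_eq_zero, add_eq_zero_iff_eq_neg]

/-- hence, for `n` odd over a field without `√−1`: **no non-zero class is mapped to a multiple of itself by the quarter turn** (no eigen-class; every non-zero stable subspace
has dimension `≥ 2`). -/
theorem SbC_quarter_apply_ne_smul_of_odd (ho : Odd n) (hK : ∀ x : K, x ^ 2 ≠ -1) {v : spikeSpan K n} (hv : v ≠ 0) (c : K) : SbC K 0 (-1) 1 0 v ≠ c • v := fun h =>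
  not_hasEigenvalue_SbC_quarter_of_odd K ho hK c
    (Module.End.hasEigenvalue_of_hasEigenvector (Module.End.hasEigenvector_iff.mpr ⟨Module.End.mem_eigenspace_iff.mpr h, hv⟩))

end Summit.Ventures.HSemireg.Wedge.HankelFrameChange
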